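import Mathlib
import HarnessLib

/-!
# Klurman–Mangerel–Teräväinen: multiplicative functions in short arithmetic progressions —
# the hybrid theorem for the Liouville function and `2`-power moduli (named fact)

Topic `Literature/NumberTheory/LFunctions` (next to `MatomakiRadziwillTaoTheorem13`, the `q = 1` case, and
`LiouvilleTwoPowerModuli`, the characters to `2`-power moduli).

Source. O. Klurman, A. P. Mangerel, J. Teräväinen, *Multiplicative functions in short arithmetic progressions*,
Proc. London Math. Soc. (3) 127 (2023), 366–446, doi:10.1112/plms.12546, arXiv:1909.12280 (held,
`paper:arxiv-1909.12280`).  §1.5, Theorem 1.6 (A Hybrid theorem) and Corollary 1.7 (real-valued `f`):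

> **Theorem 1.6.** Let `X ≥ h ≥ 10` and `1 ≤ Q ≤ h/10`. Let `(log(h/Q))^{-1/200} ≤ ε ≤ 1`. Then there is a set
> `𝒬_{X,ε} ⊂ [1,X] ∩ ℤ` satisfying `|[1,Q] \ 𝒬_{X,ε}| ≪ Q X^{−ε^{200}}` such that the following holds. Let
> `q ∈ 𝒬_{X,ε} ∩ [1,Q]` be `(h/Q)^{ε²}`-typical. Let `f : ℕ → 𝕌` be multiplicative. […] Then
> `∫_X^{2X} Σ*_{a (mod q)} |Σ_{x<n≤x+h, n≡a (q)} f(n) − (χ₁(a)/φ(q)) (∫_x^{x+h} v^{it_{χ₁}}dv) (1/X) Σ_{X<n≤2X} f(n)χ̄₁(n)n^{−it_{χ₁}}|² dx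
>  ≪ ε φ(q) X (h/q)².`
> Moreover, assuming either the GRH or that `Q ≤ X^{ε^{200}}`, the result holds for all `q ∈ [1,Q]`.
>
> **Corollary 1.7.** Let the notation be as in Theorem 1.6, and assume additionally that `f` is real-valued and that
> `h ≤ X`. Then for all `q ∈ 𝒬_{X,ε} ∩ [1,Q]` that are `(h/Q)^{ε²}`-typical we have
> `∫_X^{2X} Σ*_{a (mod q)} |Σ_{x<n≤x+h, n≡a (q)} f(n) − (χ₁(a)/φ(q)) (h/X) Σ_{X≤n≤2X} f(n)χ̄₁(n)|² dx ≪ ε φ(q) X (h/q)².`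
> Moreover, we can take `χ₁` to be a real character `(mod q)`. Again, assuming either the GRH or that
> `Q ≤ X^{ε^{200}}`, the result holds for all `q ∈ [1,Q]`.

Here `Σ*` runs over the reduced residues `a (mod q)`, and (§1.3, before Theorem 1.3) "an integer `q ≥ 1` is `y`-typical if
`Σ_{p ∣ q, p ≤ z} 1 ≤ π(z)/100` for all `z ≥ y`"; the exceptional set is
`𝒬_{X,ε} = {q ≤ X : ∏_{χ (mod q), cond χ > X^{ε^{200}}} L(s,χ) ≠ 0 on ℜs ≥ 1 − ε^{−100} log log X/log X, |ℑs| ≤ 3X}`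
(§3.2, eq. (3.3)), so that every `q ≤ X^{ε^{200}}` lies in it (proof of Theorem 1.6, end of §6).

## What is stated here (a SPECIAL CASE, in the tree's vocabulary)

`KMT2023_corollary17_liouville_twoPower`: Corollary 1.7 for `f = λ` (the Liouville function, real-valued and completely
multiplicative) and the moduli `q = 2^k`, in the UNCONDITIONAL regime `Q ≤ X^{ε^{200}}` (no exceptional set), with
the implied absolute constant made explicit (`∃ C₀`) and the real character `χ₁ (mod 2^k)` existentially quantified
(the corollary provides a specific one, the minimiser of the pretentious distance; the existential form is what the
corollary implies and all that consumers need).  The typicality hypothesis for `q = 2^k` (`k ≥ 1`; one prime factor)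
reads `1 ≤ π(z)/100` for all `z ≥ y = (h/Q)^{ε²}`, i.e. `π((h/Q)^{ε²}) ≥ 100`, i.e. `(h/Q)^{ε²} ≥ 541` (the 100th
prime); it is kept verbatim as the hypothesis `541 ≤ (h/Q)^{ε²}`.  Conventions: `x < n ≤ x + h` for real `x ≥ 0` is
`n ∈ Ioc ⌊x⌋₊ ⌊x+h⌋₊`; `X ≤ n ≤ 2X` is `n ∈ Icc ⌈X⌉₊ ⌊2X⌋₊`; the reduced residues modulo `2^k` are the `a < 2^k`
coprime to `2^k`; a real character `(mod 2^k)` is a `DirichletCharacter ℝ (2^k)` (Mathlib), evaluated at the classes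
of `a` and `n` in `ZMod (2^k)`; `φ = Nat.totient`.

-- TODO(general form): Theorem 1.6 / Corollary 1.7 for arbitrary `1`-bounded multiplicative `f : ℕ → ℂ`, arbitrary
-- typical moduli `q ∈ 𝒬_{X,ε}`, with the twisted main term `χ₁(a) n^{it_{χ₁}}` (needs the tree's language for the
-- pretentious distance `𝔻_q(f, χ n^{it}; X)` and for the exceptional set of moduli).

What is deliberately NOT here: any consequence (the window-free two-ends class of the Liouville function used by
`Summits/QuantumAdvantage/…/MobiusLadderDigitPolyUniformity*` is derived on the Summits side), and no proof — this is
a NAMED FACT (`def … : Prop`), taken as a hypothesis by its users.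
-/

namespace Literature.NumberTheory.LFunctions

open MeasureTheory

/-- **Klurman–Mangerel–Teräväinen 2023, Corollary 1.7 (with the unconditional clause of Theorem 1.6), for the
Liouville function and `2`-power moduli.**  There is an absolute constant `C₀` such that for all real
`0 < ε ≤ 1`, `X ≥ h ≥ 10`, `1 ≤ Q ≤ h/10` with `(log(h/Q))^{−1/200} ≤ ε`, `Q ≤ X^{ε^{200}}` (unconditional regime:
no exceptional moduli) and `(h/Q)^{ε²} ≥ 541` (so that every `2^k`, `k ≥ 1`, is `(h/Q)^{ε²}`-typical), and every
`k` with `2^k ≤ Q`, there is a real Dirichlet character `χ₁ (mod 2^k)` with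
`∫_X^{2X} Σ_{a<2^k, (a,2^k)=1} |Σ_{x<n≤x+h, n≡a (2^k)} λ(n) − (χ₁(a)/φ(2^k))·(h/X)·Σ_{X≤n≤2X} λ(n)χ₁(n)|² dx
 ≤ C₀ · ε · φ(2^k) · X · (h/2^k)²`.
[cite: KlurmanMangerelTeravainen2023ShortAPs, Corollary 1.7 and Theorem 1.6 (§1.5); typical moduli §1.3; exceptional set §3.2 eq. (3.3)] -/
def KMT2023_corollary17_liouville_twoPower : Prop :=
  ∃ C₀ : ℝ, 0 < C₀ ∧ ∀ ε X h Q : ℝ, 0 < ε → ε ≤ 1 → 10 ≤ h → h ≤ X → 1 ≤ Q → 10 * Q ≤ h →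
    Real.log (h / Q) ^ (-(1 / 200 : ℝ)) ≤ ε → Q ≤ X ^ (ε ^ 200) → 541 ≤ (h / Q) ^ (ε ^ 2) →
    ∀ k : ℕ, (2 : ℝ) ^ k ≤ Q →
      ∃ χ₁ : DirichletCharacter ℝ (2 ^ k),
        ∫ x in X..2 * X,
          ∑ a ∈ (Finset.range (2 ^ k)).filter (fun a => Nat.Coprime a (2 ^ k)),
            (∑ n ∈ (Finset.Ioc ⌊x⌋₊ ⌊x + h⌋₊).filter (fun n => n % 2 ^ k = a),
                (ArithmeticFunction.liouville n : ℝ) -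
              χ₁ (a : ZMod (2 ^ k)) / (Nat.totient (2 ^ k) : ℝ) * (h / X) *
                ∑ n ∈ Finset.Icc ⌈X⌉₊ ⌊2 * X⌋₊,
                  (ArithmeticFunction.liouville n : ℝ) * χ₁ (n : ZMod (2 ^ k))) ^ 2 ≤
          C₀ * ε * (Nat.totient (2 ^ k) : ℝ) * X * (h / 2 ^ k) ^ 2

end Literature.NumberTheory.LFunctions

/-! ## Relocated from `Summits/ValiantsHypothesis/ValiantsHypothesis/Theorems/LiouvilleSarnakAlignedTypeICharactersMod2nKMTVariance.lean` (gate, accept-time relocation of cited facts) — KlurmanMangerelTeravainen2023ShortAPs -/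

namespace Literature.NumberTheory.LFunctions

open ArithmeticFunction Finset
open scoped BigOperators

/-- **Klurman–Mangerel–Teräväinen 2023, Theorem 1.3 (smooth moduli), for the Liouville function and the moduli
`q = Q = 2^k`.**  There is an absolute constant `C₀ > 0` such that for all real `0 < ε ≤ 1`, all `k ≥ 1` and all real
`x` with `10 · 2^k ≤ x` (`Q = q = 2^k ≤ x/10`), `(log(x/2^k))^{-1/200} ≤ ε`, `2 ≤ (2^k)^{exp(-ε^{-4})}` (`2^k` is
`q^{ε'}`-smooth, `ε' = exp(-ε^{-4})`) and `541 ≤ (x/2^k)^{ε²}` (`2^k` is `(x/Q)^{ε²}`-typical: `π((x/Q)^{ε²}) ≥ 100`),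
there is a Dirichlet character `χ₁ (mod 2^k)` (the theorem: the minimiser of
`inf_{|t| ≤ log x} 𝔻_q(λ, χ(n)n^{it}; x)`) with
`Σ_{a ∈ (ℤ/2^k)ˣ} |Σ_{1 ≤ n ≤ x, n ≡ a (2^k)} λ(n) − (χ₁(a)/φ(2^k)) Σ_{1 ≤ n ≤ x} λ(n) χ̄₁(n)|² ≤ C₀ ε φ(2^k) (x/2^k)²`.
-- TODO(general form): Theorem 1.3 for arbitrary `1`-bounded multiplicative `f : ℕ → ℂ` and arbitrary
-- `q^{ε'}`-smooth, `(x/Q)^{ε²}`-typical `q ≤ Q ≤ x/10` (needs the tree's language for `y`-smooth / `y`-typical moduli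
-- and for the pretentious distance `𝔻_q(f, χ n^{it}; x)` naming `χ₁`).
[cite: KlurmanMangerelTeravainen2023ShortAPs, Theorem 1.3 (§1.3, arXiv:1909.12280 p. 4); typical moduli §1.3]
[file NumberTheory/LFunctions/KlurmanMangerelTeravainenShortAPs] -/
def KMT2023_theorem13_liouville_twoPower : Prop :=
  ∃ C₀ : ℝ, 0 < C₀ ∧ ∀ (ε x : ℝ) (k : ℕ), 0 < ε → ε ≤ 1 → 1 ≤ k → (10 : ℝ) * 2 ^ k ≤ x →
    Real.log (x / 2 ^ k) ^ (-(1 / 200 : ℝ)) ≤ ε → (2 : ℝ) ≤ ((2 : ℝ) ^ k) ^ Real.exp (-(ε⁻¹ ^ 4)) →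
    (541 : ℝ) ≤ (x / 2 ^ k) ^ (ε ^ 2) →
      ∃ χ₁ : DirichletCharacter ℂ (2 ^ k),
        ∑ a : (ZMod (2 ^ k))ˣ,
          ‖(∑ n ∈ (Finset.Icc 1 ⌊x⌋₊).filter (fun n : ℕ => (n : ZMod (2 ^ k)) = (a : ZMod (2 ^ k))),
              (ArithmeticFunction.liouville n : ℂ)) -
            χ₁ (a : ZMod (2 ^ k)) / (Nat.totient (2 ^ k) : ℂ) *
              ∑ n ∈ Finset.Icc 1 ⌊x⌋₊, (ArithmeticFunction.liouville n : ℂ) * star (χ₁ (n : ZMod (2 ^ k)))‖ ^ 2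
          ≤ C₀ * ε * (Nat.totient (2 ^ k) : ℝ) * (x / 2 ^ k) ^ 2

end Literature.NumberTheory.LFunctions
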